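import Mathlib
import HarnessLib

/-!
# Chart localisation of `J`-holomorphic maps and of almost complex structures

The bookkeeping that turns LOCAL statements about smooth `J`-holomorphic maps `u : ℂ → M` into a
real `n`-manifold `M` carrying a smooth field `J` of tangent endomorphisms (smoothness in the
`inTangentCoordinates` sense used by the summit statements) into statements about flat
`Jc`-holomorphic maps `ℂ → ℝⁿ` for a smooth operator field `Jc` on an open subset of `ℝⁿ`, and
the elementary devices that go with it:

* chart calculus (`ChartLocalisation.fderiv_extChartAt_comp_apply`,
  `…inTangentCoordinates_id_apply`, `…mfderiv_extChartAt_injective`): for `φ₀ = extChartAt (𝓡 n) x₀` and `u z` in the chart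
  domain, `D(φ₀ ∘ u)(z) = dφ₀ ∘ du(z)`, the frame expression of `J` is `dφ₀ ∘ J ∘ dφ₀⁻¹`, hence
  (`fderiv_chart_I_mul`) `du (iζ) = J du ζ` becomes `D(φ₀ ∘ u)(z)(iζ) = Jin (u z) (D(φ₀ ∘ u)(z) ζ)`;
  and `ContMDiffAt` gives `ContDiffAt` of `φ₀ ∘ u` (`contDiffAt_chart`);
* the coordinate structure (`inTangentCoordinates_contMDiffOn`, `exists_chartJ`): the frame
  expression of a smooth endomorphism field is smooth on the whole chart domain (it is a smooth
  section of the hom bundle), so `Jc y := Jin ((φ₀).symm y)` is a smooth field on the chart target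
  with `Jc² = -1` reading `J` through the chart;
* globalisation by cut-off (`exists_contDiff_eqOn_ball`, `exists_contDiff_sq_neg_eqOn_ball`): a
  map smooth on an open set agrees near a point with a globally smooth map; an almost complex
  structure smooth on an open set agrees near a point with a GLOBAL smooth almost complex structure
  (`Jc ∘ ψ` for a smooth retraction `ψ` of the space onto a small ball);
* uniform convergence through an embedding (`tendstoUniformlyOn_chart_of_isEmbedding`): if
  `ι ∘ F_i → ι ∘ f` uniformly for a topological embedding `ι` of a locally compact space into a
  metric space and `f` takes values in a compact subset of an open set `S` on which `φ` is
  continuous, then eventually `F_i` takes values in `S` and `φ ∘ F_i → φ ∘ f` uniformly.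

Provenance: the chart calculus and the coordinate structure are the Summits-side helpers
`Theorems/SullivanDualWitnessChargeHelper{JHolomorphicChart,ChartJ,…}.lean` and
`…HelperInTangentCoordinatesContMDiffOn.lean` of summit `SmoothPoincare4` (crux `WitnessCharge`),
re-homed for general `n`; first consumer in
Literature: the proof of `Literature.Geometry.Symplectic.jHolomorphic_isolatedIntersection_persists`
(McDuff 1991, positivity of intersections) from its flat form.
-/

noncomputable section

open scoped Manifold ContDiff Topology Bundle
open Set Filter Metric Function

namespace Literature.Geometry.Symplectic

namespace ChartLocalisation

/-! ### Chart calculus -/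

section ChartCalculus

variable {n : ℕ} {M : Type*} [TopologicalSpace M] [ChartedSpace (EuclideanSpace ℝ (Fin n)) M]
  [IsManifold (𝓡 n) ∞ M]

/-- Chain rule in a chart: for `u : ℂ → M` smooth at `z` with `u z` in the source of the chart at
`x₀`, the derivative of the chart expression `φ₀ ∘ u` at `z` is `mfderiv φ₀ (u z) ∘ mfderiv u z`
(`HasMFDerivAt.comp`, `mfderiv_eq_fderiv`). [folklore] -/
theorem fderiv_extChartAt_comp_apply {x₀ : M} {u : ℂ → M} {z : ℂ}
    (hu : ContMDiffAt 𝓘(ℝ, ℂ) (𝓡 n) ∞ u z)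
    (hz : u z ∈ (chartAt (EuclideanSpace ℝ (Fin n)) x₀).source) (v : ℂ) :
    fderiv ℝ (fun w : ℂ => extChartAt (𝓡 n) x₀ (u w)) z v =
      mfderiv (𝓡 n) 𝓘(ℝ, EuclideanSpace ℝ (Fin n)) (extChartAt (𝓡 n) x₀) (u z)
        (mfderiv 𝓘(ℝ, ℂ) (𝓡 n) u z v) := by
  have h := ((mdifferentiableAt_extChartAt (I := 𝓡 n) hz).hasMFDerivAt.comp z
    ((hu.mdifferentiableAt (by simp)).hasMFDerivAt)).mfderiv
  rw [mfderiv_eq_fderiv] at h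
  exact DFunLike.congr_fun h v

/-- The frame expression of `J` at a point `x` of the chart source, applied to a vector:
`Jin x v = A (J x (B v))` with `A = mfderiv φ₀ x`, `B = mfderivWithin (range (𝓡 n)) φ₀.symm (φ₀ x)`
(`inTangentCoordinates_eq_mfderiv_comp`). [folklore] -/
theorem inTangentCoordinates_id_apply
    (J : ∀ x : M, TangentSpace (𝓡 n) x →L[ℝ] TangentSpace (𝓡 n) x) {x₀ x : M}
    (hx : x ∈ (chartAt (EuclideanSpace ℝ (Fin n)) x₀).source) (v : EuclideanSpace ℝ (Fin n)) :
    inTangentCoordinates (𝓡 n) (𝓡 n) (id : M → M) id (fun x => J x) x₀ x v =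
      mfderiv (𝓡 n) 𝓘(ℝ, EuclideanSpace ℝ (Fin n)) (extChartAt (𝓡 n) x₀) x
        (J x (mfderivWithin 𝓘(ℝ, EuclideanSpace ℝ (Fin n)) (𝓡 n) (extChartAt (𝓡 n) x₀).symm
          (range (𝓡 n)) (extChartAt (𝓡 n) x₀ x) v)) := by
  have h := inTangentCoordinates_eq_mfderiv_comp (I := 𝓡 n) (I' := 𝓡 n) (f := (id : M → M))
    (g := (id : M → M)) (ϕ := fun x => J x) (x₀ := x₀) (x := x) hx hx
  exact DFunLike.congr_fun h v

/-- `B (A v) = v` for `A = mfderiv φ₀ x`, `B = mfderivWithin (range (𝓡 n)) φ₀.symm (φ₀ x)` and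
`x` in the chart source (`mfderivWithin_extChartAt_symm_comp_mfderiv_extChartAt'`). [folklore] -/
theorem mfderivWithin_extChartAt_symm_apply_mfderiv_extChartAt {x₀ x : M}
    (hx : x ∈ (chartAt (EuclideanSpace ℝ (Fin n)) x₀).source) (v : TangentSpace (𝓡 n) x) :
    mfderivWithin 𝓘(ℝ, EuclideanSpace ℝ (Fin n)) (𝓡 n) (extChartAt (𝓡 n) x₀).symm
        (range (𝓡 n)) (extChartAt (𝓡 n) x₀ x)
      (mfderiv (𝓡 n) 𝓘(ℝ, EuclideanSpace ℝ (Fin n)) (extChartAt (𝓡 n) x₀) x v) = v := by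
  have hx' : x ∈ (extChartAt (𝓡 n) x₀).source := by rwa [extChartAt_source]
  exact DFunLike.congr_fun (mfderivWithin_extChartAt_symm_comp_mfderiv_extChartAt' hx') v

/-- `A = mfderiv φ₀ x` is injective for `x` in the chart source (it has the left inverse `B`).
[folklore] -/
theorem mfderiv_extChartAt_injective {x₀ x : M}
    (hx : x ∈ (chartAt (EuclideanSpace ℝ (Fin n)) x₀).source) :
    Injective (mfderiv (𝓡 n) 𝓘(ℝ, EuclideanSpace ℝ (Fin n)) (extChartAt (𝓡 n) x₀) x) := by
  intro v w hvw
  rw [← mfderivWithin_extChartAt_symm_apply_mfderiv_extChartAt hx v,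
    ← mfderivWithin_extChartAt_symm_apply_mfderiv_extChartAt hx w, hvw]

/-- **A `J`-holomorphic map is flat-holomorphic in a chart** for the frame expression of `J`: if
`du(z)(iζ) = J (du(z) ζ)` for all `ζ` and `u z` lies in the source of the chart `φ₀` at `x₀`,
then `D(φ₀ ∘ u)(z)(iζ) = Jin (u z) (D(φ₀ ∘ u)(z) ζ)` where `Jin` is the frame expression
`inTangentCoordinates` of `J` (because `D(φ₀ ∘ u)(z) = A ∘ du(z)`, `Jin (u z) = A ∘ J ∘ B` and
`B ∘ A = id` with `A = mfderiv φ₀ (u z)`). [folklore] -/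
theorem fderiv_chart_I_mul (J : ∀ x : M, TangentSpace (𝓡 n) x →L[ℝ] TangentSpace (𝓡 n) x)
    {x₀ : M} {u : ℂ → M} {z : ℂ} (hu : ContMDiffAt 𝓘(ℝ, ℂ) (𝓡 n) ∞ u z)
    (hhol : ∀ ζ : ℂ, mfderiv 𝓘(ℝ, ℂ) (𝓡 n) u z (Complex.I * ζ : ℂ) =
      J (u z) (mfderiv 𝓘(ℝ, ℂ) (𝓡 n) u z (ζ : ℂ)))
    (hz : u z ∈ (chartAt (EuclideanSpace ℝ (Fin n)) x₀).source) (ζ : ℂ) :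
    fderiv ℝ (fun w : ℂ => extChartAt (𝓡 n) x₀ (u w)) z (Complex.I * ζ) =
      inTangentCoordinates (𝓡 n) (𝓡 n) (id : M → M) id (fun x => J x) x₀ (u z)
        (fderiv ℝ (fun w : ℂ => extChartAt (𝓡 n) x₀ (u w)) z ζ) := by
  rw [fderiv_extChartAt_comp_apply hu hz, fderiv_extChartAt_comp_apply hu hz,
    inTangentCoordinates_id_apply J hz, mfderivWithin_extChartAt_symm_apply_mfderiv_extChartAt hz,
    hhol ζ]

/-- Smoothness of the chart expression: if `u` is `C^∞` at `z` and `u z` lies in the source of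
the chart `φ₀` at `x₀`, then `φ₀ ∘ u` is `C^∞` at `z` (`contMDiffAt_iff_target_of_mem_source`,
`contMDiffAt_iff_contDiffAt`). [folklore] -/
theorem contDiffAt_chart {x₀ : M} {u : ℂ → M} {z : ℂ} (hu : ContMDiffAt 𝓘(ℝ, ℂ) (𝓡 n) ∞ u z)
    (hz : u z ∈ (chartAt (EuclideanSpace ℝ (Fin n)) x₀).source) :
    ContDiffAt ℝ ∞ (fun w : ℂ => extChartAt (𝓡 n) x₀ (u w)) z :=
  contMDiffAt_iff_contDiffAt.1 ((contMDiffAt_iff_target_of_mem_source hz).1 hu).2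

/-- The injectivity of `du(z)` is that of `D(φ₀ ∘ u)(z)` when `u z` lies in the chart source
(`D(φ₀ ∘ u)(z) = A ∘ du(z)` with `A` injective). [folklore] -/
theorem injective_fderiv_chart {x₀ : M} {u : ℂ → M} {z : ℂ}
    (hu : ContMDiffAt 𝓘(ℝ, ℂ) (𝓡 n) ∞ u z)
    (hz : u z ∈ (chartAt (EuclideanSpace ℝ (Fin n)) x₀).source)
    (hinj : Injective (mfderiv 𝓘(ℝ, ℂ) (𝓡 n) u z)) :
    Injective (fderiv ℝ (fun w : ℂ => extChartAt (𝓡 n) x₀ (u w)) z) := by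
  have h : ⇑(fderiv ℝ (fun w : ℂ => extChartAt (𝓡 n) x₀ (u w)) z) =
      (mfderiv (𝓡 n) 𝓘(ℝ, EuclideanSpace ℝ (Fin n)) (extChartAt (𝓡 n) x₀) (u z)) ∘
        (mfderiv 𝓘(ℝ, ℂ) (𝓡 n) u z) := funext fun v => fderiv_extChartAt_comp_apply hu hz v
  rw [h]
  exact (mfderiv_extChartAt_injective hz).comp hinj

end ChartCalculus

/-! ### The coordinate structure on a chart target -/

section CoordinateStructure

variable {n : ℕ}

/-- **The coordinate expression of a smooth endomorphism field is smooth on the whole chart.**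
If, for every `x₀ : M`, the expression `x ↦ inTangentCoordinates (𝓡 n) (𝓡 n) id id J x₀ x` of a
field of endomorphisms `J x : T_x M →L[ℝ] T_x M` in the trivialization of the tangent bundle at
`x₀` is `C^∞` at `x₀`, then for every `x₀` it is `C^∞` on the whole chart domain
`(chartAt _ x₀).source`: `J` is then a `C^∞` section of the hom bundle `Hom(TM, TM)`
(`contMDiffAt_hom_bundle`), and a `C^∞` section read in the trivialization at `x₀` is `C^∞` on
its base set (`Trivialization.contMDiffOn_section_baseSet_iff`), the chart domain of `x₀`.
[folklore] -/
theorem inTangentCoordinates_contMDiffOn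
    {M : Type*} [TopologicalSpace M] [ChartedSpace (EuclideanSpace ℝ (Fin n)) M]
    [IsManifold (𝓡 n) ∞ M]
    (J : ∀ x : M, TangentSpace (𝓡 n) x →L[ℝ] TangentSpace (𝓡 n) x)
    (hJ : ∀ x₀ : M, ContMDiffAt (𝓡 n)
      𝓘(ℝ, EuclideanSpace ℝ (Fin n) →L[ℝ] EuclideanSpace ℝ (Fin n)) ∞
      (inTangentCoordinates (𝓡 n) (𝓡 n) (id : M → M) id (fun x => J x) x₀) x₀) (x₀ : M) :
    ContMDiffOn (𝓡 n) 𝓘(ℝ, EuclideanSpace ℝ (Fin n) →L[ℝ] EuclideanSpace ℝ (Fin n)) ∞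
      (inTangentCoordinates (𝓡 n) (𝓡 n) (id : M → M) id (fun x => J x) x₀)
      (chartAt (EuclideanSpace ℝ (Fin n)) x₀).source := by
  -- `J` as a section of the hom bundle `Hom(TM, TM)` is `C^∞` everywhere
  have hsec : ContMDiff (𝓡 n)
      ((𝓡 n).prod 𝓘(ℝ, EuclideanSpace ℝ (Fin n) →L[ℝ] EuclideanSpace ℝ (Fin n))) ∞
      (fun x : M ↦ Bundle.TotalSpace.mk'
        (EuclideanSpace ℝ (Fin n) →L[ℝ] EuclideanSpace ℝ (Fin n))
        (E := fun x : M ↦ TangentSpace (𝓡 n) x →L[ℝ] TangentSpace (𝓡 n) x) x (J x)) := by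
    intro x
    rw [contMDiffAt_hom_bundle]
    exact ⟨contMDiffAt_id, hJ x⟩
  -- the trivialization of the hom bundle at `x₀`; its base set is the chart domain of `x₀`
  set e := trivializationAt (EuclideanSpace ℝ (Fin n) →L[ℝ] EuclideanSpace ℝ (Fin n))
    (fun x : M ↦ TangentSpace (𝓡 n) x →L[ℝ] TangentSpace (𝓡 n) x) x₀ with he
  have h1 : ContMDiffOn (𝓡 n) 𝓘(ℝ, EuclideanSpace ℝ (Fin n) →L[ℝ] EuclideanSpace ℝ (Fin n)) ∞
      (fun x ↦ (e ⟨x, J x⟩).2) e.baseSet :=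
    (e.contMDiffOn_section_baseSet_iff).1 hsec.contMDiffOn
  have hbase : e.baseSet = (chartAt (EuclideanSpace ℝ (Fin n)) x₀).source := by
    rw [he, hom_trivializationAt_baseSet, TangentBundle.trivializationAt_baseSet, inter_self]
  rw [← hbase]
  refine h1.congr fun x _ ↦ ?_
  rw [he, hom_trivializationAt_apply]
  rfl

/-- **The coordinate almost complex structure on a chart target.** Let `J` be a field of
endomorphisms of the tangent spaces of a `C^∞` manifold `M` modelled on `ℝⁿ` with
`J x ∘ J x = -1`, whose frame expression at every `x₀` is `C^∞` at `x₀`. Then for every `x₀`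
the field `Jc y := inTangentCoordinates … x₀ ((extChartAt (𝓡 n) x₀).symm y)` of endomorphisms
of `ℝⁿ` is `C^∞` on the target of the extended chart at `x₀`, satisfies `Jc y (Jc y v) = -v`
there, and reads `J` through the chart:
`Jc (extChartAt (𝓡 n) x₀ x) = inTangentCoordinates (𝓡 n) (𝓡 n) id id J x₀ x` on the chart
domain. [folklore] -/
theorem exists_chartJ {M : Type*} [TopologicalSpace M] [ChartedSpace (EuclideanSpace ℝ (Fin n)) M]
    [IsManifold (𝓡 n) ∞ M]
    (J : ∀ x : M, TangentSpace (𝓡 n) x →L[ℝ] TangentSpace (𝓡 n) x)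
    (hJ2 : ∀ (x : M) (v : TangentSpace (𝓡 n) x), J x (J x v) = -v)
    (hJ : ∀ x₀ : M, ContMDiffAt (𝓡 n)
      𝓘(ℝ, EuclideanSpace ℝ (Fin n) →L[ℝ] EuclideanSpace ℝ (Fin n)) ∞
      (inTangentCoordinates (𝓡 n) (𝓡 n) (id : M → M) id (fun x => J x) x₀) x₀) (x₀ : M) :
    ∃ Jc : EuclideanSpace ℝ (Fin n) → EuclideanSpace ℝ (Fin n) →L[ℝ] EuclideanSpace ℝ (Fin n),
      ContDiffOn ℝ ∞ Jc (extChartAt (𝓡 n) x₀).target ∧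
      (∀ y ∈ (extChartAt (𝓡 n) x₀).target, ∀ v, Jc y (Jc y v) = -v) ∧
      ∀ x ∈ (chartAt (EuclideanSpace ℝ (Fin n)) x₀).source,
        Jc (extChartAt (𝓡 n) x₀ x) =
          inTangentCoordinates (𝓡 n) (𝓡 n) (id : M → M) id (fun x => J x) x₀ x := by
  have hsm := inTangentCoordinates_contMDiffOn J hJ
  -- points of the chart target are sent into the chart domain by the inverse extended chart
  have hsrc : ∀ y ∈ (extChartAt (𝓡 n) x₀).target,
      (extChartAt (𝓡 n) x₀).symm y ∈ (chartAt (EuclideanSpace ℝ (Fin n)) x₀).source :=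
    fun y hy => by
    rw [← extChartAt_source (𝓡 n)]
    exact (extChartAt (𝓡 n) x₀).map_target hy
  -- the coordinate expression of `J` in the frame at `x₀`, as `A ∘ J x ∘ B` with `A`, `B` inverse
  have hexpr : ∀ {x : M}, x ∈ (chartAt (EuclideanSpace ℝ (Fin n)) x₀).source →
      ∀ w : EuclideanSpace ℝ (Fin n),
        inTangentCoordinates (𝓡 n) (𝓡 n) (id : M → M) id (fun x => J x) x₀ x w =
          tangentCoordChange (𝓡 n) x x₀ x (J x (tangentCoordChange (𝓡 n) x₀ x x w)) :=
    fun {x} hx w => by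
    rw [inTangentCoordinates_eq (I := 𝓡 n) (I' := 𝓡 n) (id : M → M) id (fun x => J x) hx hx]
    rfl
  have hBA : ∀ {x : M}, x ∈ (chartAt (EuclideanSpace ℝ (Fin n)) x₀).source →
      ∀ w : EuclideanSpace ℝ (Fin n),
        tangentCoordChange (𝓡 n) x₀ x x (tangentCoordChange (𝓡 n) x x₀ x w) = w :=
    fun {x} hx w => by
    have hx' : x ∈ (extChartAt (𝓡 n) x₀).source := by rwa [extChartAt_source]
    rw [tangentCoordChange_comp ⟨⟨mem_extChartAt_source x, hx'⟩, mem_extChartAt_source x⟩]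
    exact tangentCoordChange_self (mem_extChartAt_source x)
  have hAB : ∀ {x : M}, x ∈ (chartAt (EuclideanSpace ℝ (Fin n)) x₀).source →
      ∀ w : EuclideanSpace ℝ (Fin n),
        tangentCoordChange (𝓡 n) x x₀ x (tangentCoordChange (𝓡 n) x₀ x x w) = w :=
    fun {x} hx w => by
    have hx' : x ∈ (extChartAt (𝓡 n) x₀).source := by rwa [extChartAt_source]
    rw [tangentCoordChange_comp ⟨⟨hx', mem_extChartAt_source x⟩, hx'⟩]
    exact tangentCoordChange_self hx'
  refine ⟨fun y => inTangentCoordinates (𝓡 n) (𝓡 n) (id : M → M) id (fun x => J x) x₀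
      ((extChartAt (𝓡 n) x₀).symm y), ?_, ?_, ?_⟩
  · -- smoothness on the chart target
    have hmaps : (extChartAt (𝓡 n) x₀).target ⊆
        (extChartAt (𝓡 n) x₀).symm ⁻¹' (chartAt (EuclideanSpace ℝ (Fin n)) x₀).source :=
      fun y hy => hsrc y hy
    exact contMDiffOn_iff_contDiffOn.1 ((hsm x₀).comp (contMDiffOn_extChartAt_symm x₀) hmaps)
  · -- `Jc y ∘ Jc y = -1` on the chart target
    intro y hy v
    have hx := hsrc y hy
    dsimp only
    rw [hexpr hx, hexpr hx, hBA hx, hJ2]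
    exact ((tangentCoordChange (𝓡 n) _ x₀ _).map_neg _).trans (congrArg Neg.neg (hAB hx v))
  · -- compatibility with the coordinate expression along the chart
    intro x hx
    have hx' : x ∈ (extChartAt (𝓡 n) x₀).source := by rwa [extChartAt_source]
    dsimp only
    rw [(extChartAt (𝓡 n) x₀).left_inv hx']

end CoordinateStructure

/-! ### Globalisation by cut-off -/

section Globalisation

variable {X Y : Type*} [NormedAddCommGroup X] [NormedSpace ℝ X] [HasContDiffBump X]
  [NormedAddCommGroup Y] [NormedSpace ℝ Y]

/-- **A map smooth on an open set agrees near a point with a globally smooth map** (multiply by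
a smooth bump function centred at the point and supported in the open set). [folklore] -/
theorem exists_contDiff_eqOn_ball {f : X → Y} {U : Set X} (hU : IsOpen U)
    (hf : ContDiffOn ℝ ∞ f U) {x₀ : X} (hx₀ : x₀ ∈ U) :
    ∃ g : X → Y, ContDiff ℝ ∞ g ∧ ∃ r : ℝ, 0 < r ∧ ball x₀ r ⊆ U ∧ EqOn g f (ball x₀ r) := by
  obtain ⟨R, hR, hRU⟩ := Metric.isOpen_iff.1 hU x₀ hx₀
  let χ : ContDiffBump x₀ := ⟨R / 4, R / 2, by positivity, by linarith⟩
  refine ⟨fun x => χ x • f x, ?_, R / 4, by positivity,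
    (ball_subset_ball (by linarith)).trans hRU, fun x hx => ?_⟩
  · rw [contDiff_iff_contDiffAt]
    intro x
    by_cases hx : x ∈ U
    · exact χ.contDiff.contDiffAt.smul (hf.contDiffAt (hU.mem_nhds hx))
    · have hfar : R / 2 < dist x x₀ := by
        by_contra h
        push Not at h
        exact hx (hRU (mem_ball.2 (h.trans_lt (by linarith))))
      have hev : (fun y => χ y • f y) =ᶠ[𝓝 x] fun _ => 0 := by
        have ho : IsOpen {y : X | R / 2 < dist y x₀} :=
          isOpen_lt continuous_const (continuous_id.dist continuous_const)
        filter_upwards [ho.mem_nhds hfar] with y hy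
        rw [χ.zero_of_le_dist (show χ.rOut ≤ dist y x₀ from le_of_lt hy), zero_smul]
      exact (contDiffAt_const (c := (0 : Y))).congr_of_eventuallyEq hev
  · show χ x • f x = f x
    rw [χ.one_of_mem_closedBall (show x ∈ closedBall x₀ χ.rIn from ball_subset_closedBall hx),
      one_smul]

omit [NormedAddCommGroup Y] [NormedSpace ℝ Y] in
/-- **An almost complex structure smooth on an open set agrees near a point with a global smooth
almost complex structure**: compose with the smooth map `ψ y = y₀ + χ y • (y - y₀)` (`χ` a bump
at `y₀`), which maps the whole space into a small ball about `y₀` inside the open set and is the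
identity near `y₀`; `Jc ∘ ψ` is smooth, squares to `-1` everywhere, and equals `Jc` near `y₀`.
[folklore] -/
theorem exists_contDiff_sq_neg_eqOn_ball {Jc : X → X →L[ℝ] X} {T : Set X} (hT : IsOpen T)
    (hJc : ContDiffOn ℝ ∞ Jc T) (hJc2 : ∀ y ∈ T, ∀ v, Jc y (Jc y v) = -v) {y₀ : X}
    (hy₀ : y₀ ∈ T) :
    ∃ Jg : X → X →L[ℝ] X, ContDiff ℝ ∞ Jg ∧ (∀ y v, Jg y (Jg y v) = -v) ∧
      ∃ r : ℝ, 0 < r ∧ ball y₀ r ⊆ T ∧ EqOn Jg Jc (ball y₀ r) := by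
  obtain ⟨R, hR, hRT⟩ := Metric.isOpen_iff.1 hT y₀ hy₀
  let χ : ContDiffBump y₀ := ⟨R / 4, R / 2, by positivity, by linarith⟩
  set ψ : X → X := fun y => y₀ + χ y • (y - y₀) with hψ_def
  have hψ : ContDiff ℝ ∞ ψ :=
    contDiff_const.add (χ.contDiff.smul (contDiff_id.sub contDiff_const))
  have hψT : ∀ y, ψ y ∈ T := by
    intro y
    apply hRT
    rw [mem_ball, dist_eq_norm]
    have h1 : ψ y - y₀ = χ y • (y - y₀) := by simp only [hψ_def]; abel
    rw [h1, norm_smul, Real.norm_of_nonneg χ.nonneg]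
    by_cases h : dist y y₀ < R / 2
    · calc χ y * ‖y - y₀‖ ≤ 1 * ‖y - y₀‖ := by gcongr; exact χ.le_one
        _ < R := by rw [one_mul, ← dist_eq_norm]; linarith
    · push Not at h
      rw [χ.zero_of_le_dist (show χ.rOut ≤ dist y y₀ from h), zero_mul]
      exact hR
  have hψid : ∀ y ∈ ball y₀ (R / 4), ψ y = y := fun y hy => by
    simp only [hψ_def]
    rw [χ.one_of_mem_closedBall (show y ∈ closedBall y₀ χ.rIn from ball_subset_closedBall hy),
      one_smul]
    abel
  refine ⟨fun y => Jc (ψ y), hJc.comp_contDiff hψ hψT, fun y v => hJc2 _ (hψT y) v, R / 4,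
    by positivity, (ball_subset_ball (by linarith)).trans hRT, fun y hy => ?_⟩
  show Jc (ψ y) = Jc y
  rw [hψid y hy]

end Globalisation

/-! ### Uniform convergence through a topological embedding -/

/-- **Uniform convergence through an embedding, read in a chart.** Let `ι : V → Z` be a
topological embedding of a locally compact space into a (pseudo)metric space, `φ` continuous on
an open `S ⊆ V` with values in a (pseudo)metric space, and `F_i, f : X → V` with `f '' s` inside
a compact `K ⊆ S`. If `ι ∘ F_i → ι ∘ f` uniformly on `s`, then eventually `F_i '' s ⊆ S`, and
`φ ∘ F_i → φ ∘ f` uniformly on `s` (a compact neighbourhood `L` of `K` in `S`; `ι '' (interior L)`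
is relatively open, so the `F_i` eventually land in `L`, on whose image `φ ∘ ι⁻¹` is uniformly
continuous). [folklore] -/
theorem tendstoUniformlyOn_chart_of_isEmbedding {V Z Y X κ : Type*} [TopologicalSpace V]
    [LocallyCompactSpace V] [PseudoMetricSpace Z] [PseudoMetricSpace Y] {ι : V → Z}
    (hι : Topology.IsEmbedding ι) {φ : V → Y} {S : Set V} (hS : IsOpen S)
    (hφ : ContinuousOn φ S) {p : Filter κ} {s : Set X} {F : κ → X → V} {f : X → V} {K : Set V}
    (hK : IsCompact K) (hKS : K ⊆ S) (hfK : ∀ x ∈ s, f x ∈ K)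
    (h : TendstoUniformlyOn (fun i x => ι (F i x)) (fun x => ι (f x)) p s) :
    TendstoUniformlyOn (fun i x => φ (F i x)) (fun x => φ (f x)) p s ∧
      ∀ᶠ i in p, ∀ x ∈ s, F i x ∈ S := by
  -- the degenerate case `K = ∅` (then `s = ∅`)
  rcases K.eq_empty_or_nonempty with hK0 | ⟨k₀, -⟩
  · have hs : ∀ x, x ∉ s := fun x hx => by simpa [hK0] using hfK x hx
    exact ⟨fun u _ => Eventually.of_forall fun i x hx => (hs x hx).elim,
      Eventually.of_forall fun i x hx => (hs x hx).elim⟩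
  -- a compact neighbourhood `L` of `K` inside `S`
  obtain ⟨L, hL, hKL, hLS⟩ := exists_compact_between hK hS hKS
  -- `ι '' interior L` is relatively open: `ι ⁻¹' O = interior L` for an open `O`
  obtain ⟨O, hO, hOL⟩ := hι.isInducing.isOpen_iff.1 (isOpen_interior (s := L))
  have heK : IsCompact (ι '' K) := hK.image hι.continuous
  have heKO : ι '' K ⊆ O := by
    rintro _ ⟨x, hx, rfl⟩
    rw [← mem_preimage, hOL]
    exact hKL hx
  obtain ⟨δ, hδ, hδO⟩ := heK.exists_thickening_subset_open hO heKO
  have hev : ∀ᶠ i in p, ∀ x ∈ s, F i x ∈ interior L := by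
    filter_upwards [Metric.tendstoUniformlyOn_iff.1 h δ hδ] with i hi x hx
    have h1 : ι (F i x) ∈ O := hδO (mem_thickening_iff.2
      ⟨ι (f x), mem_image_of_mem ι (hfK x hx), by rw [dist_comm]; exact hi x hx⟩)
    rwa [← mem_preimage, hOL] at h1
  refine ⟨?_, hev.mono fun i hi x hx => hLS (interior_subset (hi x hx))⟩
  -- `g := φ ∘ ι⁻¹` on `ι '' L` is uniformly continuous
  set g : Z → Y := Function.extend ι φ (fun _ => φ k₀) with hg_def
  have hge : ∀ x, g (ι x) = φ x := fun x => hι.injective.extend_apply _ _ x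
  have hcomp : g ∘ ι = φ := funext hge
  have hgc : ContinuousOn g (ι '' L) := by
    rintro _ ⟨x, hx, rfl⟩
    show Tendsto g (𝓝[ι '' L] (ι x)) (𝓝 (g (ι x)))
    rw [← hι.map_nhdsWithin_eq, Filter.tendsto_map'_iff, hcomp, hge]
    exact (hφ x (hLS hx)).mono_left (nhdsWithin_mono x hLS)
  have hgu : UniformContinuousOn g (ι '' L) :=
    (hL.image hι.continuous).uniformContinuousOn_of_continuous hgc
  rw [Metric.tendstoUniformlyOn_iff]
  intro ε hε
  obtain ⟨δ', hδ', hδ'g⟩ := Metric.uniformContinuousOn_iff.1 hgu ε hε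
  filter_upwards [hev, Metric.tendstoUniformlyOn_iff.1 h δ' hδ'] with i hi hi' x hx
  have hfx : f x ∈ L := interior_subset (hKL (hfK x hx))
  have h1 := hδ'g (ι (f x)) (mem_image_of_mem ι hfx) (ι (F i x))
    (mem_image_of_mem ι (interior_subset (hi x hx))) (hi' x hx)
  rwa [hge, hge] at h1

end ChartLocalisation

end Literature.Geometry.Symplectic

end
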